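import Summits.BirchSwinnertonDyer.BirchSwinnertonDyer.Theorems.KimAtThreeKolyvaginCertificateDictionary
import Summits.BirchSwinnertonDyer.Rank1Residual.Supersingular.KobayashiMainConjectureKuriharaRigidity
import Literature.NumberTheory.EllipticCurves.Rank1Residual.Typed.X7
import HarnessLib

/-!
# Crux `KobayashiLowerHalfLargeImage` (item stmt-BirchSwinnertonDyer-19001), line `kurihara_rigidity`: the PER-PAIR
# CERTIFICATE CONSUMERS — one explicit non-zero Kurihara number at one cyclic Kolyvagin level ⟹ BOTH signed main
# conjectures at the pair (hence the crux's conclusion there), modulo the line's named inputs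
# (cell `bsd-ssimc`, seat `bsd-line-slh-p1`, lead of the line; written for a future kit/census seat)

HONEST FRAMING (D-0152): theorems only, CONDITIONAL on displayed named facts / OPEN preprint binders and on an
EXPLICIT certificate supplied by the caller (a record file); nothing is asserted about any curve here; nothing is
booked; BSD is not proved by any of this. Shapes offered (instantiate with a datum `D.f` at any level `N`):
* `kobayashiMainConjecture_of_unitCertificate` — rows `p ∤ ∏ c_ℓ`: a cyclic `n ∈ 𝒩₁(W,p)` with
  `kuriharaNumber f p n ψ ≠ 0` ⟹ `KobayashiMainConjecture W p ε` (both signs), GRANTED `Kim2026_thm111_via_kobayashi74`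
  (PUBLISHED: Kim 1.11 ∘ Kobayashi 7.4 — derived in the tree from Kim 1.11 on Kato's objects + Kobayashi 7.4 in the
  kernel, `…KuriharaRigidityBindersOfFacts`) and the period fact. PUBLISHED INPUTS ONLY.
* `kobayashiMainConjecture_of_certificate` — any `t = ord_p ∏ c_ℓ`: a cyclic `n ∈ 𝒩_k(W,p)`, `k ≤ t + 1`, with
  `kuriharaNumber f (p^k) n ψ ≠ 0` ⟹ both signs, GRANTED the two Castella–Sano readings
  (`CastellaSano2026_thm1_via_kobayashi74_OPEN`, `CastellaSano2026_sec2_tamagawaDefectGe_implicit_OPEN`, PREPRINT) and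
  the period fact; `E` non-CM needed here.
* the `KobayashiLowerDivisibility` corollaries (the crux's conclusion at the pair, sign `+1`).
The certificate ⟹ `≤`-half step is `kuriharaPartialInfty ≤ k − 1 ≤ t` (`kuriharaDivIndex_le_coe_iff`,
`not_kuriharaDivisibleAt_of_kuriharaNumber_ne_zero` of `KimAtThreeKolyvaginCertificateDictionary`).

References: [Kim2022StructureSelmer] Thm 1.11, §1.5.1, Conj 1.10; [CastellaSano2026] Thm 1, §2 (PRE); [Kobayashi2003]
Thm 7.4, Conjecture (p. 2).
-/

set_option autoImplicit false
-- the Theorems namespace of a single-conjunct summit repeats the summit name by design (D-0017)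
set_option linter.dupNamespace false

noncomputable section

open scoped Classical MatrixGroups ModularForm

open CongruenceSubgroup WeierstrassCurve Literature.NumberTheory.EllipticCurves
  Literature.NumberTheory.EllipticCurves.ModularForms
  Literature.NumberTheory.EllipticCurves.Rank1Residual
  Literature.NumberTheory.EllipticCurves.Rank1Residual.Typed
  Summit.BirchSwinnertonDyer.Rank1Residual.Supersingular
  Summit.BirchSwinnertonDyer.Rank1Residual.X4
  Summit.BirchSwinnertonDyer.BirchSwinnertonDyer.Theorems.KimAtThreeKolyvaginCertificateDictionary

namespace Summit.BirchSwinnertonDyer.BirchSwinnertonDyer.Theorems.KuriharaRigidity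

variable (W : WeierstrassCurve ℚ) [W.IsElliptic] [W.IsGloballyMinimal] (p : ℕ) [Fact p.Prime]

omit [W.IsElliptic] [Fact p.Prime] in
/-- **Certificate ⟹ the `≤` half at the pair**: a cyclic Kolyvagin level `n ∈ 𝒩_k(W,p)` with `k ≤ ord_p ∏ c_ℓ + 1`,
surjective discrete logarithms `ψ`, and `kuriharaNumber f (p^k) n ψ ≠ 0` give `X4.KimTamagawaDefectLeAt W p f`
(`∂^{(∞)} ≤ ∂^{(ν(n))} ≤ ord δ̃_n ≤ k − 1`). Unconditional bookkeeping.
[cite: Kim2022StructureSelmer, §1.5.1 (PDF p. 7) and Conj. 1.10 (PDF p. 8)] -/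
theorem kimTamagawaDefectLeAt_of_certificate {N : ℕ} (f : CuspForm (Gamma0 N) 2) {n k : ℕ}
    (hn : IsCyclicKolyvaginLevel W p n) (hk : Kato.IsKolyvaginProduct W p k n)
    (hkt : k ≤ padicValNat p W.tamagawaProduct + 1)
    (ψ : (ℓ : ℕ) → (ZMod ℓ)ˣ →* Multiplicative (ZMod (p ^ k)))
    (hψ : ∀ ℓ ∈ n.primeFactors, Function.Surjective (ψ ℓ))
    (hne : haveI : NeZero n := ⟨hk.ne_zero⟩; kuriharaNumber f (p ^ k) n ψ ≠ 0) :
    KimTamagawaDefectLeAt W p f := by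
  haveI : NeZero n := ⟨hk.ne_zero⟩
  have hndiv : ¬ KuriharaDivisibleAt W p f n (padicValNat p W.tamagawaProduct + 1) :=
    not_kuriharaDivisibleAt_of_kuriharaNumber_ne_zero W p f hkt hk ψ hψ hne
  exact (kuriharaPartialInfty_le W p f _).trans ((kuriharaPartial_le W p f hn rfl).trans
    ((kuriharaDivIndex_le_coe_iff W p f n _).mpr hndiv))

/-- **Rows `p ∤ ∏ c_ℓ`: ONE unit Kurihara number ⟹ BOTH signed main conjectures at the pair, PUBLISHED inputs only.**
At `p ≥ 5` good with `a_p = 0`, `ρ̄` onto, `p ∤ ∏ c_ℓ`: a cyclic level `n ∈ 𝒩₁(W,p)` (`#Ẽ(𝔽_ℓ)[p] ≤ p` at `ℓ ∣ n`) with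
surjective `ψ` and `kuriharaNumber f p n ψ ≠ 0`, for a newform `f` of `W` at any level, gives `KobayashiMainConjecture W p ε`
for every `ε` — GRANTED `Kim2026_thm111_via_kobayashi74` (`hKK`) and `realPeriodRat_eq_unit_mul_plusPeriod` (`h5`).
CONDITIONAL on the two named facts; closes nothing. [cite: Kim2022StructureSelmer, Thm. 1.11 (1) ⟹ (3)]
[cite: Kobayashi2003, Thm. 7.4 (p. 13)] -/
theorem kobayashiMainConjecture_of_unitCertificate (hKK : Kim2026_thm111_via_kobayashi74)
    (h5 : realPeriodRat_eq_unit_mul_plusPeriod) (hp5 : 5 ≤ p) (hgood : W.HasGoodReductionAtPrime p)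
    (hap : W.frobeniusTrace p = 0) (hs : Surj W p) (htam : ¬ p ∣ W.tamagawaProduct)
    {N : ℕ} [NeZero N] (f : CuspForm (Gamma0 N) 2) (hf : IsNewformOf W f)
    {n : ℕ} [NeZero n] (hn1 : Kato.IsKolyvaginProduct W p 1 n)
    (hcyc : ∀ (ℓ : ℕ) [Fact ℓ.Prime], ℓ ∣ n →
      Nat.card {P : ((WeierstrassCurve.integralModelInt W).map
          (Int.castRingHom (ZMod ℓ))).toAffine.Point // p • P = 0} ≤ p)
    (ψ : (ℓ : ℕ) → (ZMod ℓ)ˣ →* Multiplicative (ZMod (p ^ 1)))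
    (hψ : ∀ ℓ ∈ n.primeFactors, Function.Surjective (ψ ℓ)) (hne : kuriharaNumber f (p ^ 1) n ψ ≠ 0)
    (ε : ℤˣ) : KobayashiMainConjecture W p ε :=
  kobayashiMainConjecture_of_kuriharaUnitAt W p hKK h5 hp5 hgood hap hs htam f hf
    ⟨n, inferInstance, hn1, hcyc, ψ, hψ, hne⟩ ε

/-- **… hence the crux's conclusion at such a pair** (sign `+1`), PUBLISHED inputs + one unit Kurihara number.
CONDITIONAL; closes nothing. [cite: Kim2022StructureSelmer, Thm. 1.11 (1) ⟹ (3)] [cite: Kobayashi2003, Thm. 7.4 (p. 13) and Conjecture (p. 2)] -/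
theorem kobayashiLowerDivisibility_of_unitCertificate (hKK : Kim2026_thm111_via_kobayashi74)
    (h5 : realPeriodRat_eq_unit_mul_plusPeriod) (hp5 : 5 ≤ p) (hgood : W.HasGoodReductionAtPrime p)
    (hap : W.frobeniusTrace p = 0) (hs : Surj W p) (htam : ¬ p ∣ W.tamagawaProduct)
    {N : ℕ} [NeZero N] (f : CuspForm (Gamma0 N) 2) (hf : IsNewformOf W f)
    {n : ℕ} [NeZero n] (hn1 : Kato.IsKolyvaginProduct W p 1 n)
    (hcyc : ∀ (ℓ : ℕ) [Fact ℓ.Prime], ℓ ∣ n →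
      Nat.card {P : ((WeierstrassCurve.integralModelInt W).map
          (Int.castRingHom (ZMod ℓ))).toAffine.Point // p • P = 0} ≤ p)
    (ψ : (ℓ : ℕ) → (ZMod ℓ)ˣ →* Multiplicative (ZMod (p ^ 1)))
    (hψ : ∀ ℓ ∈ n.primeFactors, Function.Surjective (ψ ℓ)) (hne : kuriharaNumber f (p ^ 1) n ψ ≠ 0) :
    ∃ ε : ℤˣ, KobayashiLowerDivisibility W p ε :=
  ⟨1, kobayashiLowerDivisibility_of_mainConjecture
    (kobayashiMainConjecture_of_unitCertificate W p hKK h5 hp5 hgood hap hs htam f hf hn1 hcyc ψ hψ hne 1)⟩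

/-- **Any `t = ord_p ∏ c_ℓ`: ONE Kurihara number non-zero modulo `p^k` at a cyclic level `n ∈ 𝒩_k`, `k ≤ t + 1`, ⟹ BOTH
signed main conjectures at the pair**, for `W` non-CM, `p ≥ 5` good, `a_p = 0`, `ρ̄` onto — GRANTED the Castella–Sano
readings `CastellaSano2026_thm1_via_kobayashi74_OPEN` (`hCS`), `CastellaSano2026_sec2_tamagawaDefectGe_implicit_OPEN` (`hCSge`)
(PREPRINT) and the period fact (`h5`). CONDITIONAL; closes nothing.
[claim: CastellaSano2026, status: under-review] [cite: Kobayashi2003, Thm. 7.4 (p. 13)] -/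
theorem kobayashiMainConjecture_of_certificate (hCS : CastellaSano2026_thm1_via_kobayashi74_OPEN)
    (hCSge : CastellaSano2026_sec2_tamagawaDefectGe_implicit_OPEN) (h5 : realPeriodRat_eq_unit_mul_plusPeriod)
    (hp5 : 5 ≤ p) (hgood : W.HasGoodReductionAtPrime p) (hap : W.frobeniusTrace p = 0) (hcm : ¬ W.HasCM)
    (hs : Surj W p) {N : ℕ} [NeZero N] (f : CuspForm (Gamma0 N) 2) (hf : IsNewformOf W f) {n k : ℕ}
    (hn : IsCyclicKolyvaginLevel W p n) (hk : Kato.IsKolyvaginProduct W p k n)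
    (hkt : k ≤ padicValNat p W.tamagawaProduct + 1)
    (ψ : (ℓ : ℕ) → (ZMod ℓ)ˣ →* Multiplicative (ZMod (p ^ k)))
    (hψ : ∀ ℓ ∈ n.primeFactors, Function.Surjective (ψ ℓ))
    (hne : haveI : NeZero n := ⟨hk.ne_zero⟩; kuriharaNumber f (p ^ k) n ψ ≠ 0) (ε : ℤˣ) :
    KobayashiMainConjecture W p ε :=
  Summit.BirchSwinnertonDyer.Rank1Residual.Supersingular.KuriharaRigidity.signedMC_of_kimTamagawaDefectLe hCS hCSge
    h5 W p hp5 hgood hap hcm hs f hf (kimTamagawaDefectLeAt_of_certificate W p f hn hk hkt ψ hψ hne) ε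

/-- **… hence the crux's conclusion at such a pair** (sign `+1`). CONDITIONAL; closes nothing.
[claim: CastellaSano2026, status: under-review] [cite: Kobayashi2003, Thm. 7.4 (p. 13) and Conjecture (p. 2)] -/
theorem kobayashiLowerDivisibility_of_certificate (hCS : CastellaSano2026_thm1_via_kobayashi74_OPEN)
    (hCSge : CastellaSano2026_sec2_tamagawaDefectGe_implicit_OPEN) (h5 : realPeriodRat_eq_unit_mul_plusPeriod)
    (hp5 : 5 ≤ p) (hgood : W.HasGoodReductionAtPrime p) (hap : W.frobeniusTrace p = 0) (hcm : ¬ W.HasCM)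
    (hs : Surj W p) {N : ℕ} [NeZero N] (f : CuspForm (Gamma0 N) 2) (hf : IsNewformOf W f) {n k : ℕ}
    (hn : IsCyclicKolyvaginLevel W p n) (hk : Kato.IsKolyvaginProduct W p k n)
    (hkt : k ≤ padicValNat p W.tamagawaProduct + 1)
    (ψ : (ℓ : ℕ) → (ZMod ℓ)ˣ →* Multiplicative (ZMod (p ^ k)))
    (hψ : ∀ ℓ ∈ n.primeFactors, Function.Surjective (ψ ℓ))
    (hne : haveI : NeZero n := ⟨hk.ne_zero⟩; kuriharaNumber f (p ^ k) n ψ ≠ 0) :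
    ∃ ε : ℤˣ, KobayashiLowerDivisibility W p ε :=
  ⟨1, kobayashiLowerDivisibility_of_mainConjecture
    (kobayashiMainConjecture_of_certificate W p hCS hCSge h5 hp5 hgood hap hcm hs f hf hn hk hkt ψ hψ hne 1)⟩

end Summit.BirchSwinnertonDyer.BirchSwinnertonDyer.Theorems.KuriharaRigidity

end
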